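import Mathlib
import Literature.NumberTheory.LFunctions.RepulsiveLogFreeDensitySingleModulus
import Literature.NumberTheory.Sieve.LevelOfDistribution
import HarnessLib

/-!
# Chen–Gupta–Li, *Large value estimates for Dirichlet polynomials with characters and zero density
# of Dirichlet `L`-functions* (arXiv:2507.08296v2, 27 Jul 2026), §1: Theorem 1.1 (the Guth–Maynard
# large-values estimate for `Σ a_n χ(n) n^{it}`, `χ` primitive mod `q`), Theorem 1.2 (zero density
# for the family `{L(s,χ)}_{χ mod q}`, exponent `7/3`), Corollary 1.3 (least Goldbach number mod `p`)
# and Corollary 1.5 (primes in progressions to prime-power moduli in intervals `h/φ(q) ≥ x^{17/30+ε}`)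

Topic `Literature/NumberTheory/LFunctions` (namespace `Literature.NumberTheory.LFunctions`, paper
sub-namespace `ChenGuptaLi2025`). STATEMENT LAYER (D-0014/D-0064: one file for the paper's §1): named
facts (`def … : Prop`; STATUS: preprint CLAIMS — the source is an unrefereed arXiv preprint (v2,
July 2026), tagged `[claim: ChenGuptaLi2025, status: under-review]` per fact, to be cited as claims
until a refereed version exists — ls-lit-ref 2026-08-26T17:35Z) over honest definitions. VOCABULARY REUSED, NOT
RE-DECLARED: the printed zero count `N(σ,T,χ) = #{ρ = β+it : L(ρ,χ) = 0, σ ≤ β ≤ 1, |t| ≤ T}` summed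
over ALL `χ (mod q)` is the tree's `ThornerZaman2024PNTAP.modZeroCount q σ T`
(`= Σ_{χ mod q} (zeroSetGe χ σ T).ncard`, `zeroSetGe χ σ T = {ρ : L(ρ,χ) = 0, σ ≤ Re ρ, |Im ρ| ≤ T}`,
file `RepulsiveLogFreeDensitySingleModulus.lean`; for `σ > 0` the condition `β ≤ 1` is automatic);
`ψ(x;q,a)` is the tree's `Literature.NumberTheory.Sieve.LevelOfDistribution.chebyshevPsiMod`
(file `Sieve/LevelOfDistribution.lean`). The `7/3` bound restricted to PRIMITIVE characters and
counted WITH multiplicity is already recorded as `BondarenkoHeap2026.prop2`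
(`BondarenkoHeap2026Sections3to5.lean`, Bondarenko–Heap's Proposition 2, attributed there to this
paper); the present file types the source's own statements. Typed for the Landau–Siegel programme
(rung F-S3, §C harvest row T-037, tag `detector`; §B-det START-HERE): the `q`-aspect Guth–Maynard
LARGE-VALUES estimate (how often a character-twisted Dirichlet polynomial of length `N` is `≥ V` —
the detecting-polynomial input of every zero-density argument) and the resulting density
`Σ_χ N(σ,T,χ) ≪_ε (qT)^{7(1−σ)/3+ε}`. Density theorems COUNT zeros off the line; nothing here bears on
exceptional zeros beyond what is printed.

## Source and version

B. Chen, V. Gupta, Y. C. Li, arXiv:2507.08296**v2** (27 Jul 2026) [ChenGuptaLi2025] — read from the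
arXiv TeX source (`cgl_v2.tex`, 180 779 bytes, sha256 `0b9ebb6b…`; a copy is kept in the cell folder
`run/shared/lean/pub/landau-siegel/lit/src-arxiv-2507.08296v2/`); locators `l.` = TeX line. The held
corpus text `paper:arxiv-2507.08296` is **v1** (B. Chen alone, 11 Jul 2025: Theorem 1.3 = large
values with `(qT)^ε`-separation in the ranges `(qT)^{3/4} ≤ N ≤ (qT)^{5/6}`, `N ≥ (qT)^{5/6}`;
Theorem 1.4 = `Σ_χ N(σ,T,χ) ⪅ (qT)^{4(1−σ)/(1+σ)}`; Corollaries 1.5–1.6); v2 ("the result of the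
authors' subsequent collaboration", title-page statement l.88) supersedes it with the divisor-aspect
statements below, and only v2 is typed. The v1 harvest locator of row T-037 (Thm 1.4, p0003:L70–76)
corresponds to v2 Theorem 1.2.

## What the source prints (v2)

Abstract (l.92–97): "It is proved that `Σ_{χ mod q} N(σ,T,χ) ≪_ε (qT)^{7(1−σ)/3+ε}`, where `N(σ,T,χ)`
denotes the number of zeros `ρ = β+it` of `L(s,χ)` in the rectangle `σ ≤ β ≤ 1`, `|t| ≤ T`. The
exponent `7/3` improves upon Huxley's earlier exponent of `12/5`."

> **Theorem 1.1** (Large value estimate for Dirichlet polynomials with characters; l.114–128). Let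
> `D_N(t,χ) = Σ_{N < n ≤ 2N} a_n χ(n) n^{it}`, where `χ` is a primitive character modulo `q` and
> `|a_n| ≤ 1`. Suppose that `W` is a finite set of pairs `(t,χ)`, where `|t| ≤ T` and for
> `(t,χ) ≠ (t',χ')` either `χ ≠ χ'` or `|t − t'| ≥ 1`. Assume that `|D_N(t,χ)| ≥ V` for all `(t,χ) ∈ W`
> and `N ≥ (qT)^{2/3}`. Then for any divisor `q₁ ∣ q`, we have
> `|W| ≤ (qT)^{o(1)}(N²V^{−2} + q q₁^{−1/2} T^{1/2} N³V^{−4} + q q₁^{1/3} T N²V^{−4} + qT N^{12/5}V^{−4})`.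
> In all cases, we have
> `|W| ≤ (qT)^{o(1)}(N²V^{−2} + (qT)^{1/2}N³V^{−4} + q^{4/3}TN²V^{−4} + qTN^{12/5}V^{−4})`.

(l.141: "Let `N(σ,T,χ)` denote the number of zeros `ρ = β+it` of `L(s,χ)` in the rectangle
`σ ≤ β ≤ 1`, `|t| ≤ T`.")

> **Theorem 1.2** (Zero-density estimate; l.158–186). For any divisor `q₁ ∣ q` and `1/2 < σ < 1`, we
> have `Σ_{χ mod q} N(σ,T,χ) ≤ (qT)^{o(1)}((q₁^{1/3}qT)^{3(1−σ)/(1+σ)} + (qT(q₁T)^{−1/2})^{3(1−σ)/σ}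
> + (q₁T)^{−1/2}(qT)^{(21−20σ)/6} + (qT)^{15(1−σ)/(3+5σ)})`.
> If `q₁ ∣ q` and `q₁ ≥ √q`, we also have `Σ_{χ mod q} N(σ,T,χ) ≤ (qT)^{o(1)}((q₁^{1/3}q²T²)^{1−σ}
> + (q³T^{9/4}q₁^{−3/4})^{1−σ} + (qT)^{B(1−σ)} + (qT)^{30(1−σ)/13})`, where
> `B = (37 + 3β − √(9β² + 222β − 71))/12` and `β = log(q₁T)/log(qT)`.
> In all cases, we have `Σ_{χ mod q} N(σ,T,χ) ≤ (qT)^{o(1)}(q^{7(1−σ)/3}T^{2(1−σ)} + (qT)^{30(1−σ)/13})`.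
> If `q` is `T`-smooth, then `Σ_{χ mod q} N(σ,T,χ) ≤ (qT)^{30(1−σ)/13 + o(1)}`.

"The best exponent `A` in `Σ_{χ mod q} N(σ,T,χ) ≤ (qT)^{A(1−σ)+o(1)}` that we get from Theorem 1.2
uniformly in `q` and `T` is `A = 7/3`." (l.187.)

> **Corollary 1.3** (l.191–194). Let `p` be an odd prime, `(p,k) = 1` and let `G(p,k)` be the least
> Goldbach's number (a number of the form `p₁ + p₂` with `p₁`, `p₂` primes) that is congruent to `k`
> modulo `p`. Then `G(p,k) ≪_ε p^{7/6+ε}`.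

> **Corollary 1.5** (Primes in arithmetic progressions for prime-power moduli; l.248–261). Let
> `h ≤ x` and suppose that `q = q₁^n` for some prime `q₁` such that `q₁ ≤ (log x)^A` for some absolute
> constant `A`. Let `(a,q) = 1`. Then `ψ(x+h;q,a) − ψ(x;q,a) = (1 + o_{ε,A}(1)) h/φ(q)` provided that
> `h/φ(q) ≥ x^{17/30+ε}`.

§1.1 Notation (l.269–270): "`A ≪_z B` … we write `A ⪅ B` to indicate that for any `ε > 0`, there
exists a constant `C(ε) > 0`, depending only on `ε`, such that `A ≤ C(ε)(qT)^ε B` for all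
sufficiently large `qT`. … Asymptotic quantities such as `o(1)` are interpreted as `qT → ∞`."

## Lean rendering / design choices

* `(qT)^{o(1)}` FACTORS. By the printed convention (`o(1)` as `qT → ∞`, constants depending on
  nothing else), "`X ≤ (qT)^{o(1)} Y`" is: for every `ε > 0` there is `C = C(ε)` with
  `X ≤ C (qT)^ε Y` — uniformly in all other data (`N`, `V`, `a_n`, `W`, `q₁`, `σ`). The clause "for
  all sufficiently large `qT`" is absorbed into `C` exactly as in the tree's rendering of
  Guth–Maynard's Theorem 1.1 (`GuthMaynard2026_theorem_1_1`): we record `T ≥ 1` (print's `T` is a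
  height; for bounded `qT` with `T ≥ 1` every count below is bounded and every right-hand side is
  `≥ C`), which only narrows the data.
* LARGE VALUES. `charDirichletPoly a N t χ = Σ_{n ∈ (N,2N]} a_n χ(n) n^{it}` (`N : ℕ`, principal
  complex power `n^{it}`); `W : Finset (ℝ × DirichletCharacter ℂ q)`; the printed admissibility
  (`χ` primitive mod `q`, `|t| ≤ T`, `1`-separation within each character, `|D_N| ≥ V` on `W`) is the
  predicate `IsLargeValueSet`; `V > 0` is recorded (the bounds carry `V^{−2}`, `V^{−4}`).
* ZERO DENSITY. `Σ_{χ mod q} N(σ,T,χ) = ThornerZaman2024PNTAP.modZeroCount q σ T` (distinct zeros,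
  `Set.ncard`, as in that file — the reading print's "number of zeros" certainly implies). The four
  displays of Theorem 1.2 are four named facts; "`q` is `T`-smooth" = every prime factor of `q` is
  `≤ T`, i.e. `q ∈ Nat.smoothNumbers (⌊T⌋₊ + 1)`. The abstract's headline `≪_ε (qT)^{7(1−σ)/3+ε}` is
  typed as printed (constant depending on `ε` only, `1/2 < σ < 1` as in Theorem 1.2, `T ≥ 1`), and
  the bookkeeping lemma `allCases_bound_le` proves that the "in all cases" right-hand side is
  `≤ 2 (qT)^{7(1−σ)/3}` (so the headline is the all-cases display up to the constant).
* COROLLARY 1.3 = existence of a Goldbach number `p₁ + p₂ ≡ k (mod p)` below `C(ε) p^{7/6+ε}`.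
  COROLLARY 1.5: "`= (1 + o_{ε,A}(1)) h/φ(q)`" = for every `δ > 0` there is `x₀ = x₀(ε,A,δ)` beyond
  which `|ψ(x+h;q,a) − ψ(x;q,a) − h/φ(q)| ≤ δ h/φ(q)`, uniformly in `h ≤ x`, `q = q₁^n` (`n ≥ 1`,
  `q₁ ≤ (log x)^A` prime) and `(a,q) = 1` subject to `h/φ(q) ≥ x^{17/30+ε}`.
* No instances, no notation.

## Deliberately not here

Corollary 1.4 (primes in progressions in short intervals under a hypothetical zero-free region
`η(q,T)` with `η(q, x^{ε/3}T₀) log x → ∞`, `T₀ = (x/h)^{1+o(1)}` — a conditional asymptotic whose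
hypothesis is itself asymptotic; a route that needs it should state the instance it uses); the
comparison displays (1.1)–(1.4) (`qT`-mean-value, Halász–Montgomery–Huxley, Ingham, Huxley `12/5`);
the body of the paper (§§2–9: the GCD-twisted affine-transformation sum, the `S₁/S₂/S₃`
decomposition); v1-only statements (v1 Theorem 1.4, v1 Corollary 1.5 on `p(p^n,k)`).

References: [cite: ChenGuptaLi2025, Abstract; Theorem 1.1; Theorem 1.2; Corollary 1.3;
Corollary 1.5; §1.1 (arXiv v2 TeX l.92–97, 114–128, 141, 158–187, 191–194, 248–261, 269–270)].

«The programme SEARCHES and TYPES; no claim about Landau–Siegel zeros, Theorems 1–2 of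
arXiv:2211.02515 or a repaired Margin232 until a kernel theorem says so.»
-/

noncomputable section

open scoped Classical
open Complex Finset

namespace Literature.NumberTheory.LFunctions

namespace ChenGuptaLi2025

open ThornerZaman2024PNTAP (modZeroCount)
open Literature.NumberTheory.Sieve (LevelOfDistribution.chebyshevPsiMod)

/-! ### Theorem 1.1: large values of `Σ a_n χ(n) n^{it}` -/

/-- `D_N(t,χ) = Σ_{N < n ≤ 2N} a_n χ(n) n^{it}` (principal complex power `n^{it}`).
[cite: ChenGuptaLi2025, Theorem 1.1 (display defining D_N)] -/
def charDirichletPoly {q : ℕ} (a : ℕ → ℂ) (N : ℕ) (t : ℝ) (χ : DirichletCharacter ℂ q) : ℂ :=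
  ∑ n ∈ Ioc N (2 * N), a n * χ (n : ZMod q) * ((n : ℂ) ^ ((t : ℂ) * I))

/-- The printed admissibility of a large-value set `W` of pairs `(t,χ)`: every `χ` occurring is
primitive modulo `q`, `|t| ≤ T`, distinct pairs with the same character are `1`-separated
("for `(t,χ) ≠ (t',χ')` either `χ ≠ χ'` or `|t − t'| ≥ 1`"), and `|D_N(t,χ)| ≥ V` on `W`.
[cite: ChenGuptaLi2025, Theorem 1.1 (hypotheses)] -/
def IsLargeValueSet {q : ℕ} (a : ℕ → ℂ) (N : ℕ) (T V : ℝ)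
    (W : Finset (ℝ × DirichletCharacter ℂ q)) : Prop :=
  (∀ w ∈ W, w.2.IsPrimitive ∧ |w.1| ≤ T ∧ V ≤ ‖charDirichletPoly a N w.1 w.2‖) ∧
    ∀ w ∈ W, ∀ w' ∈ W, w ≠ w' → w.2 ≠ w'.2 ∨ 1 ≤ |w.1 - w'.1|

/-- **Chen–Gupta–Li, Theorem 1.1** (first display, divisor aspect): for `|a_n| ≤ 1`, `W` an
admissible large-value set at level `V` (`IsLargeValueSet`), `N ≥ (qT)^{2/3}` and any divisor
`q₁ ∣ q`, `|W| ≤ (qT)^{o(1)}(N²V^{−2} + q q₁^{−1/2}T^{1/2}N³V^{−4} + q q₁^{1/3}TN²V^{−4} + qTN^{12/5}V^{−4})`.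
Rendered (`(qT)^{o(1)}` convention of §1.1): for every `ε > 0` there is `C` such that for all
`q ≥ 1`, `q₁ ∣ q`, `T ≥ 1`, `N ≥ (qT)^{2/3}`, `V > 0`, coefficients `|a_n| ≤ 1` and admissible `W`,
`|W| ≤ C (qT)^ε (…)`. Status: preprint claim, unrefereed [claim: ChenGuptaLi2025, status: under-review].
[cite: ChenGuptaLi2025, Theorem 1.1 (first display), arXiv v2 TeX l.114–124] -/
def theorem11 : Prop :=
  ∀ ε : ℝ, 0 < ε → ∃ C : ℝ, ∀ (q : ℕ) [NeZero q] (q₁ : ℕ) (T : ℝ) (N : ℕ) (V : ℝ) (a : ℕ → ℂ)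
    (W : Finset (ℝ × DirichletCharacter ℂ q)),
    q₁ ∣ q → 1 ≤ T → ((q : ℝ) * T) ^ (2 / 3 : ℝ) ≤ N → 0 < V → (∀ n, ‖a n‖ ≤ 1) →
    IsLargeValueSet a N T V W →
      (W.card : ℝ) ≤ C * ((q : ℝ) * T) ^ ε *
        ((N : ℝ) ^ 2 * V⁻¹ ^ 2 +
          (q : ℝ) * (q₁ : ℝ) ^ (-(1 / 2) : ℝ) * T ^ (1 / 2 : ℝ) * (N : ℝ) ^ 3 * V⁻¹ ^ 4 +
          (q : ℝ) * (q₁ : ℝ) ^ (1 / 3 : ℝ) * T * (N : ℝ) ^ 2 * V⁻¹ ^ 4 +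
          (q : ℝ) * T * (N : ℝ) ^ (12 / 5 : ℝ) * V⁻¹ ^ 4)

/-- **Chen–Gupta–Li, Theorem 1.1** ("In all cases" display): under the same hypotheses,
`|W| ≤ (qT)^{o(1)}(N²V^{−2} + (qT)^{1/2}N³V^{−4} + q^{4/3}TN²V^{−4} + qTN^{12/5}V^{−4})`.
Status: preprint claim, unrefereed [claim: ChenGuptaLi2025, status: under-review]. [cite: ChenGuptaLi2025, Theorem 1.1 ("In all cases"), arXiv v2 TeX l.125–128] -/
def theorem11_allCases : Prop :=
  ∀ ε : ℝ, 0 < ε → ∃ C : ℝ, ∀ (q : ℕ) [NeZero q] (T : ℝ) (N : ℕ) (V : ℝ) (a : ℕ → ℂ)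
    (W : Finset (ℝ × DirichletCharacter ℂ q)),
    1 ≤ T → ((q : ℝ) * T) ^ (2 / 3 : ℝ) ≤ N → 0 < V → (∀ n, ‖a n‖ ≤ 1) →
    IsLargeValueSet a N T V W →
      (W.card : ℝ) ≤ C * ((q : ℝ) * T) ^ ε *
        ((N : ℝ) ^ 2 * V⁻¹ ^ 2 + ((q : ℝ) * T) ^ (1 / 2 : ℝ) * (N : ℝ) ^ 3 * V⁻¹ ^ 4 +
          (q : ℝ) ^ (4 / 3 : ℝ) * T * (N : ℝ) ^ 2 * V⁻¹ ^ 4 +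
          (q : ℝ) * T * (N : ℝ) ^ (12 / 5 : ℝ) * V⁻¹ ^ 4)

/-! ### Theorem 1.2: zero density for `{L(s,χ)}_{χ mod q}` -/

/-- The printed exponent `B = (37 + 3β − √(9β² + 222β − 71))/12` of the second display of
Theorem 1.2 (`β = log(q₁T)/log(qT)`). [cite: ChenGuptaLi2025, Theorem 1.2 (second display)] -/
def bExponent (β : ℝ) : ℝ :=
  (37 + 3 * β - Real.sqrt (9 * β ^ 2 + 222 * β - 71)) / 12

/-- **Chen–Gupta–Li, Theorem 1.2** (first display, divisor aspect): for any divisor `q₁ ∣ q` and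
`1/2 < σ < 1`, `Σ_{χ mod q} N(σ,T,χ) ≤ (qT)^{o(1)}((q₁^{1/3}qT)^{3(1−σ)/(1+σ)}
+ (qT(q₁T)^{−1/2})^{3(1−σ)/σ} + (q₁T)^{−1/2}(qT)^{(21−20σ)/6} + (qT)^{15(1−σ)/(3+5σ)})`, with the
`(qT)^{o(1)}` convention (for every `ε > 0` a constant `C(ε)`, `T ≥ 1`). Status: preprint claim, unrefereed [claim: ChenGuptaLi2025, status: under-review].
[cite: ChenGuptaLi2025, Theorem 1.2 (first display), arXiv v2 TeX l.158–170] -/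
def theorem12 : Prop :=
  ∀ ε : ℝ, 0 < ε → ∃ C : ℝ, ∀ (q : ℕ) [NeZero q] (q₁ : ℕ) (T σ : ℝ),
    q₁ ∣ q → 1 ≤ T → 1 / 2 < σ → σ < 1 →
      (modZeroCount q σ T : ℝ) ≤ C * ((q : ℝ) * T) ^ ε *
        (((q₁ : ℝ) ^ (1 / 3 : ℝ) * q * T) ^ (3 * (1 - σ) / (1 + σ)) +
          ((q : ℝ) * T * ((q₁ : ℝ) * T) ^ (-(1 / 2) : ℝ)) ^ (3 * (1 - σ) / σ) +
          ((q₁ : ℝ) * T) ^ (-(1 / 2) : ℝ) * ((q : ℝ) * T) ^ ((21 - 20 * σ) / 6) +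
          ((q : ℝ) * T) ^ (15 * (1 - σ) / (3 + 5 * σ)))

/-- **Chen–Gupta–Li, Theorem 1.2** (second display, large divisor): if `q₁ ∣ q` and `q₁ ≥ √q`, then
for `1/2 < σ < 1`, `Σ_{χ mod q} N(σ,T,χ) ≤ (qT)^{o(1)}((q₁^{1/3}q²T²)^{1−σ} + (q³T^{9/4}q₁^{−3/4})^{1−σ}
+ (qT)^{B(1−σ)} + (qT)^{30(1−σ)/13})` with `B = bExponent (log(q₁T)/log(qT))`.
Status: preprint claim, unrefereed [claim: ChenGuptaLi2025, status: under-review]. [cite: ChenGuptaLi2025, Theorem 1.2 (second display), arXiv v2 TeX l.171–177] -/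
def theorem12_largeDivisor : Prop :=
  ∀ ε : ℝ, 0 < ε → ∃ C : ℝ, ∀ (q : ℕ) [NeZero q] (q₁ : ℕ) (T σ : ℝ),
    q₁ ∣ q → Real.sqrt q ≤ q₁ → 1 ≤ T → 1 / 2 < σ → σ < 1 →
      (modZeroCount q σ T : ℝ) ≤ C * ((q : ℝ) * T) ^ ε *
        ((((q₁ : ℝ) ^ (1 / 3 : ℝ) * (q : ℝ) ^ 2 * T ^ 2) ^ (1 - σ)) +
          ((q : ℝ) ^ 3 * T ^ (9 / 4 : ℝ) * (q₁ : ℝ) ^ (-(3 / 4) : ℝ)) ^ (1 - σ) +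
          ((q : ℝ) * T) ^ (bExponent (Real.log ((q₁ : ℝ) * T) / Real.log ((q : ℝ) * T)) * (1 - σ)) +
          ((q : ℝ) * T) ^ (30 * (1 - σ) / 13))

/-- **Chen–Gupta–Li, Theorem 1.2** ("In all cases" display): for `1/2 < σ < 1`,
`Σ_{χ mod q} N(σ,T,χ) ≤ (qT)^{o(1)}(q^{7(1−σ)/3}T^{2(1−σ)} + (qT)^{30(1−σ)/13})`.
Status: preprint claim, unrefereed [claim: ChenGuptaLi2025, status: under-review]. [cite: ChenGuptaLi2025, Theorem 1.2 ("In all cases"), arXiv v2 TeX l.178–182] -/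
def theorem12_allCases : Prop :=
  ∀ ε : ℝ, 0 < ε → ∃ C : ℝ, ∀ (q : ℕ) [NeZero q] (T σ : ℝ), 1 ≤ T → 1 / 2 < σ → σ < 1 →
    (modZeroCount q σ T : ℝ) ≤ C * ((q : ℝ) * T) ^ ε *
      ((q : ℝ) ^ (7 * (1 - σ) / 3) * T ^ (2 * (1 - σ)) + ((q : ℝ) * T) ^ (30 * (1 - σ) / 13))

/-- **Chen–Gupta–Li, Theorem 1.2** (last display): if `q` is `T`-smooth (every prime factor of `q` is
`≤ T`, i.e. `q ∈ Nat.smoothNumbers (⌊T⌋₊ + 1)`), then for `1/2 < σ < 1`,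
`Σ_{χ mod q} N(σ,T,χ) ≤ (qT)^{30(1−σ)/13 + o(1)}`. Status: preprint claim, unrefereed [claim: ChenGuptaLi2025, status: under-review].
[cite: ChenGuptaLi2025, Theorem 1.2 (T-smooth display), arXiv v2 TeX l.183–186] -/
def theorem12_smooth : Prop :=
  ∀ ε : ℝ, 0 < ε → ∃ C : ℝ, ∀ (q : ℕ) [NeZero q] (T σ : ℝ), 1 ≤ T → 1 / 2 < σ → σ < 1 →
    q ∈ Nat.smoothNumbers (⌊T⌋₊ + 1) →
      (modZeroCount q σ T : ℝ) ≤ C * ((q : ℝ) * T) ^ (30 * (1 - σ) / 13 + ε)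

/-- **Chen–Gupta–Li, the headline** (Abstract; §1 "the best exponent … uniformly in `q` and `T` is
`A = 7/3`"): `Σ_{χ mod q} N(σ,T,χ) ≪_ε (qT)^{7(1−σ)/3+ε}`. Rendered with the constant depending on `ε`
only, for `T ≥ 1` and `1/2 < σ < 1` (the range of Theorem 1.2). Status: preprint claim, unrefereed [claim: ChenGuptaLi2025, status: under-review].
[cite: ChenGuptaLi2025, Abstract (arXiv v2 TeX l.92–97) and §1 l.187] -/
def zeroDensitySevenThirds : Prop :=
  ∀ ε : ℝ, 0 < ε → ∃ C : ℝ, ∀ (q : ℕ) [NeZero q] (T σ : ℝ), 1 ≤ T → 1 / 2 < σ → σ < 1 →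
    (modZeroCount q σ T : ℝ) ≤ C * ((q : ℝ) * T) ^ (7 * (1 - σ) / 3 + ε)

/-! ### Corollaries 1.3 and 1.5 -/

/-- **Chen–Gupta–Li, Corollary 1.3**: for an odd prime `p` and `(p,k) = 1`, the least Goldbach number
(`p₁ + p₂`, `p₁, p₂` primes) congruent to `k` modulo `p` is `≪_ε p^{7/6+ε}`; i.e. for every `ε > 0`
there is `C(ε)` such that some `p₁ + p₂ ≡ k (mod p)` has `p₁ + p₂ ≤ C p^{7/6+ε}`.
Status: preprint claim, unrefereed [claim: ChenGuptaLi2025, status: under-review]. [cite: ChenGuptaLi2025, Corollary 1.3, arXiv v2 TeX l.191–194] -/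
def corollary13 : Prop :=
  ∀ ε : ℝ, 0 < ε → ∃ C : ℝ, ∀ p : ℕ, p.Prime → p ≠ 2 → ∀ k : ℤ, ¬ (p : ℤ) ∣ k →
    ∃ p₁ p₂ : ℕ, p₁.Prime ∧ p₂.Prime ∧ ((p₁ + p₂ : ℕ) : ZMod p) = (k : ZMod p) ∧
      ((p₁ + p₂ : ℕ) : ℝ) ≤ C * (p : ℝ) ^ (7 / 6 + ε)

/-- **Chen–Gupta–Li, Corollary 1.5** (primes in arithmetic progressions for prime-power moduli):
for `h ≤ x`, `q = q₁^n` with `q₁ ≤ (log x)^A` prime, `(a,q) = 1` and `h/φ(q) ≥ x^{17/30+ε}`,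
`ψ(x+h;q,a) − ψ(x;q,a) = (1 + o_{ε,A}(1)) h/φ(q)`. Rendered: for every `ε, A, δ > 0` there is
`x₀ = x₀(ε,A,δ)` such that for all `x ≥ x₀` and all such `h, q₁, n ≥ 1, a`,
`|ψ(x+h;q,a) − ψ(x;q,a) − h/φ(q)| ≤ δ h/φ(q)` (`ψ(x;q,a)` = the tree's `chebyshevPsiMod`).
Status: preprint claim, unrefereed [claim: ChenGuptaLi2025, status: under-review]. [cite: ChenGuptaLi2025, Corollary 1.5, arXiv v2 TeX l.248–261] -/
def corollary15 : Prop :=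
  ∀ ε A δ : ℝ, 0 < ε → 0 < A → 0 < δ → ∃ x₀ : ℝ, ∀ (x h : ℝ) (q₁ n : ℕ),
    x₀ ≤ x → h ≤ x → q₁.Prime → (q₁ : ℝ) ≤ Real.log x ^ A → 1 ≤ n →
    ∀ a : ZMod (q₁ ^ n), IsUnit a →
      x ^ (17 / 30 + ε) ≤ h / (Nat.totient (q₁ ^ n) : ℝ) →
        |LevelOfDistribution.chebyshevPsiMod (q₁ ^ n) a (x + h) -
            LevelOfDistribution.chebyshevPsiMod (q₁ ^ n) a x - h / (Nat.totient (q₁ ^ n) : ℝ)| ≤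
          δ * (h / (Nat.totient (q₁ ^ n) : ℝ))

/-! ### Bookkeeping (proved) -/

/-- `|D_N(t,χ)| ≤ N` when `|a_n| ≤ 1`: the sum has `N` terms of modulus `≤ 1` (so large-value levels
`V > N` are vacuous). [cite: ChenGuptaLi2025, Theorem 1.1 (hypotheses `|a_n| ≤ 1`, `|D_N(t,χ)| ≥ V`)] -/
theorem norm_charDirichletPoly_le {q : ℕ} (a : ℕ → ℂ) (ha : ∀ n, ‖a n‖ ≤ 1) (N : ℕ) (t : ℝ)
    (χ : DirichletCharacter ℂ q) : ‖charDirichletPoly a N t χ‖ ≤ N := by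
  unfold charDirichletPoly
  calc ‖∑ n ∈ Ioc N (2 * N), a n * χ (n : ZMod q) * ((n : ℂ) ^ ((t : ℂ) * I))‖
      ≤ ∑ n ∈ Ioc N (2 * N), ‖a n * χ (n : ZMod q) * ((n : ℂ) ^ ((t : ℂ) * I))‖ :=
        norm_sum_le _ _
    _ ≤ ∑ _n ∈ Ioc N (2 * N), (1 : ℝ) := by
        refine sum_le_sum fun n hn => ?_
        have hn0 : 0 < n := lt_of_le_of_lt (Nat.zero_le N) (mem_Ioc.1 hn).1
        rw [norm_mul, norm_mul, Complex.norm_natCast_cpow_of_pos hn0]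
        simp only [mul_re, ofReal_re, I_re, mul_zero, ofReal_im, I_im, mul_one, sub_self,
          Real.rpow_zero, mul_one]
        exact mul_le_one₀ (ha n) (norm_nonneg _) (χ.norm_le_one _)
    _ = N := by simp; omega

/-- A large-value set is empty above the trivial bound: if `V > N` then `W = ∅`.
[cite: ChenGuptaLi2025, Theorem 1.1 (hypotheses)] -/
theorem IsLargeValueSet.eq_empty_of_lt {q : ℕ} {a : ℕ → ℂ} (ha : ∀ n, ‖a n‖ ≤ 1) {N : ℕ}
    {T V : ℝ} {W : Finset (ℝ × DirichletCharacter ℂ q)} (hW : IsLargeValueSet a N T V W)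
    (hV : (N : ℝ) < V) : W = ∅ := by
  refine Finset.eq_empty_of_forall_notMem fun w hw => ?_
  have h := (hW.1 w hw).2.2
  exact absurd (h.trans (norm_charDirichletPoly_le a ha N w.1 w.2)) (not_le.2 hV)

/-- The "in all cases" right-hand side of Theorem 1.2 is at most `2 (qT)^{7(1−σ)/3}` for `q, T ≥ 1`,
`σ < 1`: `q^{7(1−σ)/3}T^{2(1−σ)} ≤ (qT)^{7(1−σ)/3}` (as `T^{2(1−σ)} ≤ T^{7(1−σ)/3}`) and
`(qT)^{30(1−σ)/13} ≤ (qT)^{7(1−σ)/3}` (as `30/13 < 7/3`) — the arithmetic behind "the best exponent …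
is `A = 7/3`". [cite: ChenGuptaLi2025, §1 (sentence after Theorem 1.2, arXiv v2 TeX l.187)] -/
theorem allCases_bound_le {q T σ : ℝ} (hq : 1 ≤ q) (hT : 1 ≤ T) (hσ : σ < 1) :
    q ^ (7 * (1 - σ) / 3) * T ^ (2 * (1 - σ)) + (q * T) ^ (30 * (1 - σ) / 13) ≤
      2 * (q * T) ^ (7 * (1 - σ) / 3) := by
  have hqT : 1 ≤ q * T := one_le_mul_of_one_le_of_one_le hq hT
  have h1 : q ^ (7 * (1 - σ) / 3) * T ^ (2 * (1 - σ)) ≤ (q * T) ^ (7 * (1 - σ) / 3) := by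
    rw [Real.mul_rpow (by linarith) (by linarith)]
    refine mul_le_mul_of_nonneg_left ?_ (Real.rpow_nonneg (by linarith) _)
    exact Real.rpow_le_rpow_of_exponent_le hT (by nlinarith)
  have h2 : (q * T) ^ (30 * (1 - σ) / 13) ≤ (q * T) ^ (7 * (1 - σ) / 3) :=
    Real.rpow_le_rpow_of_exponent_le hqT (by nlinarith)
  linarith

/-- Consequently the "in all cases" display gives the `7/3` headline with constant `2C(ε)`
(on `T ≥ 1`, `1/2 < σ < 1`). [cite: ChenGuptaLi2025, Abstract and Theorem 1.2 ("In all cases")] -/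
theorem zeroDensitySevenThirds_of_allCases (h : theorem12_allCases) : zeroDensitySevenThirds := by
  intro ε hε
  obtain ⟨C, hC⟩ := h ε hε
  refine ⟨max C 0 * 2, fun q _ T σ hT hσ hσ' => ?_⟩
  have hq : (1 : ℝ) ≤ q := by exact_mod_cast Nat.one_le_iff_ne_zero.2 (NeZero.ne q)
  have hqT : (1 : ℝ) ≤ q * T := one_le_mul_of_one_le_of_one_le hq hT
  have hqT0 : (0 : ℝ) ≤ q * T := by linarith
  have hB := allCases_bound_le hq hT hσ'
  have hpos : 0 ≤ (q : ℝ) ^ (7 * (1 - σ) / 3) * T ^ (2 * (1 - σ)) +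
      ((q : ℝ) * T) ^ (30 * (1 - σ) / 13) := by positivity
  calc (modZeroCount q σ T : ℝ)
      ≤ C * ((q : ℝ) * T) ^ ε * ((q : ℝ) ^ (7 * (1 - σ) / 3) * T ^ (2 * (1 - σ)) +
          ((q : ℝ) * T) ^ (30 * (1 - σ) / 13)) := hC q T σ hT hσ hσ'
    _ ≤ max C 0 * ((q : ℝ) * T) ^ ε * (2 * ((q : ℝ) * T) ^ (7 * (1 - σ) / 3)) := by
        have hε0 : 0 ≤ ((q : ℝ) * T) ^ ε := Real.rpow_nonneg hqT0 _
        calc C * ((q : ℝ) * T) ^ ε * _ ≤ max C 0 * ((q : ℝ) * T) ^ ε * _ :=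
              mul_le_mul_of_nonneg_right (mul_le_mul_of_nonneg_right (le_max_left _ _) hε0) hpos
          _ ≤ _ := mul_le_mul_of_nonneg_left hB (mul_nonneg (le_max_right _ _) hε0)
    _ = max C 0 * 2 * ((q : ℝ) * T) ^ (7 * (1 - σ) / 3 + ε) := by
        rw [Real.rpow_add (by linarith)]; ring

end ChenGuptaLi2025

end Literature.NumberTheory.LFunctions
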